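import Summits.QuantumFields.BalabanUV.Beta.GAN24.T2SlotUnits
import Summits.QuantumFields.BalabanUV.Beta.GAN24.ThirdJetKernel

/-!
# `BalabanUV.Beta.GAN24.T2RecursionAffine` — binder row G-an2-4 / (CONV-C), W-slot: THE NORMALISED RECURSION OF an2's BI-STENCIL FAMILY
# `T2Of` (leaf-19's `T2SlotUnits.unitS₂_T2Of_succ`, (T2-REC)) IS AFFINE IN THE PREVIOUS MEMBER — the linear part `lin4` displayed, the
# one-step difference form, and the sharp dilated-read rate brick (idle leaf seat `b2b-balaban-gan24-formalise-leaf-04`, gen 22; name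
# PROVISIONAL — the row owner gan24-p1 / the (P4) author an2 may rename or re-home it)

NOT IN PRINT; OUR BOOKKEEPING.  HONEST FRAMING (cell contract, verbatim): «discharging `BetaPertH` makes Bałaban's UV stability
UNCONDITIONAL — a real constructive-QFT result; it is NOT the continuum limit and NOT the Clay problem.»  HONEST DEPENDENCY (verbatim):
«continuum YM on T⁴ ⇐ BetaPertH ∧ nine spine estimates (0/9 proved); BetaPertH ⇐ (D1) ∧ (D4) ∧ CAP+tail; G-an2-4 gates asym, D1 and
NE2/3/4.»  [folklore] kernel algebra: an2's second response-derivative `BalabanStepW2.K3OfK K N S M W` is AFFINE in its second-table slot `W`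
(the third summand `−K∘W∘K`; additivity of `ExpKernelCalculus.comp` under absolute convergence — `KernelWard.comp_sub_left/right` and slices BY NAME), an2's carrier
`SecondOrderResponse.W2SymOfK K N S M S₂ M₂` is AFFINE in its bi-stencil slot `S₂` (the bi-vertex `vertex2OfK` summand; the zero table gives
the zero bi-vertex — pure algebra, no convergence needed), whence leaf-19's normalised recursion `T2SlotUnits.unitS₂_T2Of_succ` (T2-REC) splits as
`T♮_{j+1} = A♮_j + lin4 (cE₂·Lc^{2(d+1)}) K♮_j Lc T♮_j` with `A♮_j` free of `T♮_j` and the LINEAR PART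
`lin4 c K N T κ u κ′ u′ := −c • mmRead N (K ∘ vsym K N T κ u κ′ u′ ∘ K)`, `vsym K N T μ y ν y′ := ½•(vertex2OfK K N T μ y ν y′ + vertex2OfK K N T ν y′ μ y)`
(two plumbing `def`s, displayed so that the W-slot's located crux has a name).  No estimate, no cited fact, no `def … : Prop`, no wall
binder; 0 sorry.  NOTHING of «T2Shape» / «T2SupRate» / (hW, hWall) is asserted or discharged; NOT «W-slot closed», NEVER «G-an2-4 closed»;
NOT BetaPertH, NOT continuum, NOT Clay.

READING (docstring level — never a hypothesis or a conclusion): «T2Shape» for an2's `T2Of` (leaf-07's `WSlotOfShapes.hW_of_shapes` input)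
is the `j`-UNIFORM boundedness, in the `LocStencil₂` currency, of the orbit of the affine maps `T ↦ A♮_j + lin4 (cE₂·Lc^{2(d+1)}) K♮_j Lc T`;
the inhomogeneity `A♮_j` and the coefficients of `lin4` are built from `j`-uniformly controlled tree data (K-slot `UnitDecayK` for `K♮_j`,
«E3Shape» for `S♮_j`, leaf-07's `j`-free `M♮_j = cΛ • hessFF`, `M₂♮_j = mixFF`), so the W-slot's analytic crux is the `j`-uniform control of
the compositions of `lin4 (cE₂·Lc^{2(d+1)}) K♮_j Lc`.  Its crude one-step bound in the sup-entry currency does NOT contract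
(`SecondOrderResponse.vertexFamily₂_vertex2OfK` → `biLoc_comp_decays` → `biLoc_mmRead`: constant gain
`≥ |cE₂|·Lc^{2(d+1)}·(d+1)²·|F|²·C_K⁴·(four Zl ≥ 1)` per step, and the rate ledger `m ↦ m/16 ↦ m/128 ↦ ·Lc` only closes with the sharp
dilated read of §0 and small losses — the swarm's readings leaf-14 l.6956 / leaf-02 l.7060 of the cell journal, our arithmetic), so «T2Shape»
cannot be had by iterating one-step bricks on `j`; the located road is the one road S3 took for «E3Shape»: a LEVEL-UNROLLED (closed composite)
form of the value 4-jet with every level-`m` insertion read at level `n` carrying its own `θ^{n−m}` from a moment cancellation, bounded at a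
FIXED rate — else a certified smallness of the colour constant `cE₂` against the K-slot constants, or Bałaban's inductive analyticity bounds
transported to the typed tables (O-an2-2 / O-asym1-1, NOT IN PRINT as typed).  «T2SupRate»/«T2Drift» is the one-step difference of the same
orbit (§4).  Nothing of this paragraph is asserted.

## What is proved (generic `d`, generic blocking `N`)
* §0 `biLoc_mmRead_dilate` — THE SHARP DILATED READ: `BiLoc F (M•p′) (M•q′) C δ → BiLoc (mmRead M F) p′ q′ C (M·δ)` (the tree's
  `biLoc_mmRead` keeps `δ`): the rate gain that keeps per-level locality rates fixed in running units.
* §1 `vertexOfK_zero_table`, `vertex2OfK_zero`, `W2OfK_eq_add_vertex2OfK` (`W2OfK K N S M S₂ M₂ b b′ = W2OfK K N S M 0 M₂ b b′ + vertex2OfK K N S₂ b b′`),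
  `vsym`, `W2SymOfK_eq_add_vsym` (`W2SymOfK K N S M S₂ M₂ = W2SymOfK K N S M 0 M₂ + vsym K N S₂`) — pure algebra.
* §2 **`K3OfK_eq_sub_of_W`**: for `K` decaying at rate `δ > 0` and two second tables `W`, `W′` bi-localised at rate `δ` at the bond pair,
  `K3OfK K N S M W b b′ = K3OfK K N S M W′ b b′ − K ∘ (W b b′ − W′ b b′) ∘ K` (`KernelWard.comp_sub_left/right` BY NAME).
* §3 `lin4`, `lin4_apply`, **`unitS₂_T2Of_succ_affine`** — (T2-REC) in the K-slot units, split into the `T♮_j`-free part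
  and `lin4 (cE₂·Lc^{2(d+1)}) K♮_j Lc T♮_j` (hypotheses: `K♮_j` decays at some rate `δ > 0`; the normalised second-order member `W♮_j` and its `T♮_j`-free part are `VertexFamily₂` at
  rate `δ` — the wall's uniform W-row at level `j` resp. an2's `vertexFamily₂_W2SymOfK` on the zero bi-table; all series absolutely convergent;
  `ThirdJetKernel.mmRead_sub` BY NAME).
* §4 `unitS₂_T2Of_succ_sub` — the one-step DIFFERENCE form of (T2-REC): the border cancels exactly, leaving `cE₂·Lc^{2(d+1)}` times the
  difference of the value 4-jet carriers of the normalised step-`(j+1)` / step-`j` data (the entrywise object of «T2SupRate», leaf-01's route).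
-/

noncomputable section

open Finset
open scoped BigOperators
open Literature.MathematicalPhysics.QuantumFieldTheory
open Literature.MathematicalPhysics.QuantumFieldTheory.Balaban1983to89
open Literature.MathematicalPhysics.QuantumFieldTheory.Balaban1983to89.Beta
open ExpKernelCalculus (MKer Decays BiLoc VertexFamily₂ comp biLoc_comp_decays)
open OneStepResolventKernel (Fib wsum)
open OneStepKernelFamily (colH vertexOfK KInvStep)
open StepJetData (mfNeg)
open SecondOrderResponse (dM K2OfK vertex2OfK mixOfK W2OfK W2SymOfK W2OfK_apply)
open BalabanStepJetsSucc (mmRead mmRead_inl_inl mmRead_inr_left mmRead_inr_right)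
open BalabanStepW2 (K3OfK Spure M1 M2Of T2Of)
open KernelWard (Bdd bdd_of_decays slices_bdd_biLoc slices_biLoc_bdd comp_sub_left comp_sub_right)
open Summit.QuantumFields.BalabanUV.Beta.GAN24.ThirdJetKernel (mmRead_sub)
open Summit.QuantumFields.BalabanUV.Beta.HessKerDressedUnits (unitK unitS)
open Summit.QuantumFields.BalabanUV.Beta.SecondOrderUnits (unitM unitS₂ unitM₂)
open Summit.QuantumFields.BalabanUV.Beta.GAN24.CombesThomas (sfStep smStep)
open Summit.QuantumFields.BalabanUV.Beta.GAN24.T2SlotUnits (unitS₂_T2Of_succ)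

namespace Summit.QuantumFields.BalabanUV.Beta.GAN24.T2RecursionAffine

variable {d : ℕ}

/-! ## §0 Rate-ledger brick: the read-out at dilated points MULTIPLIES the locality rate by the blocking -/

/-- [folklore] **THE SHARP DILATED READ**: a kernel bi-localised at the dilated points `(M•p′, M•q′)` at rate `δ ≥ 0` reads out, at blocking
`M`, to a kernel bi-localised at `(p′, q′)` at rate `M·δ` in the COARSE units, same constant, ANY real `δ` (`ExpKernelCalculus.l1_natSmul`;
the tree's `BalabanStepJetsSucc.biLoc_mmRead` keeps `δ` and discards the factor `M`). This is the rate gain that lets per-level locality rates be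
kept FIXED in running units (cf. the fixed-rate rows of road S3). -/
theorem biLoc_mmRead_dilate (M : ℕ) {F : MKer (d + 1) (Fib d)} {C δ : ℝ} {p' q' : Fin (d + 1) → ℤ}
    (hF : BiLoc F ((M : ℤ) • p') ((M : ℤ) • q') C δ) : BiLoc (mmRead M F) p' q' C ((M : ℝ) * δ) := by
  have hC : 0 ≤ C := hF.nonneg (Sum.inl 0)
  intro x' z' a b
  rcases a with α | μ
  · rcases b with β | ν
    · rw [mmRead_inl_inl]
      refine (hF _ _ _ _).trans (le_of_eq ?_)
      rw [← smul_sub, ← smul_sub, ExpKernelCalculus.l1_natSmul, ExpKernelCalculus.l1_natSmul]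
      ring_nf
    · rw [mmRead_inr_right, abs_zero]; positivity
  · rw [mmRead_inr_left, abs_zero]; positivity

/-! ## §1 The carrier is affine in its bi-stencil slot (pure algebra) -/

section AffineS2

variable (K : MKer (d + 1) (Fib d)) (N : ℕ)

/-- [folklore] The chain-rule vertex of the ZERO table is the zero kernel (every term of every series is `0`). -/
theorem vertexOfK_zero_table (μ : Fin (d + 1)) (y : Fin (d + 1) → ℤ) :
    vertexOfK K N (0 : Fin (d + 1) → (Fin (d + 1) → ℤ) → MKer (d + 1) (Fib d)) μ y = 0 := by
  funext x z a b
  simp only [vertexOfK, wsum, Pi.zero_apply, mul_zero, tsum_zero, Finset.sum_const_zero]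

/-- [folklore] The bi-vertex of the ZERO bi-stencil table is the zero kernel. -/
theorem vertex2OfK_zero (μ : Fin (d + 1)) (y : Fin (d + 1) → ℤ) (ν : Fin (d + 1)) (y' : Fin (d + 1) → ℤ) :
    vertex2OfK K N (0 : Fin (d + 1) → (Fin (d + 1) → ℤ) → Fin (d + 1) → (Fin (d + 1) → ℤ) → MKer (d + 1) (Fib d)) μ y ν y' = 0 := by
  unfold vertex2OfK
  have h : (fun κ u => vertexOfK K N ((0 : Fin (d + 1) → (Fin (d + 1) → ℤ) → Fin (d + 1) → (Fin (d + 1) → ℤ) →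
      MKer (d + 1) (Fib d)) κ u) ν y') = (0 : Fin (d + 1) → (Fin (d + 1) → ℤ) → MKer (d + 1) (Fib d)) := by
    funext κ u
    simp only [Pi.zero_apply]
    exact vertexOfK_zero_table K N ν y'
  rw [h]
  exact vertexOfK_zero_table K N μ y

/-- [folklore] **`W2OfK` IS AFFINE IN ITS BI-STENCIL SLOT**: `W2OfK K N S M S₂ M₂ b b′ = W2OfK K N S M 0 M₂ b b′ + vertex2OfK K N S₂ b b′`
(the four summands of `W2OfK_apply`; only the bi-vertex sees `S₂`, and it vanishes on the zero table). -/
theorem W2OfK_eq_add_vertex2OfK (S M : Fin (d + 1) → (Fin (d + 1) → ℤ) → MKer (d + 1) (Fib d))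
    (S₂ M₂ : Fin (d + 1) → (Fin (d + 1) → ℤ) → Fin (d + 1) → (Fin (d + 1) → ℤ) → MKer (d + 1) (Fib d))
    (μ : Fin (d + 1)) (y : Fin (d + 1) → ℤ) (ν : Fin (d + 1)) (y' : Fin (d + 1) → ℤ) :
    W2OfK K N S M S₂ M₂ μ y ν y' = W2OfK K N S M 0 M₂ μ y ν y' + vertex2OfK K N S₂ μ y ν y' := by
  rw [W2OfK_apply, W2OfK_apply, vertex2OfK_zero]
  abel

/-- [folklore] Plumbing `def`: **THE SYMMETRISED BI-VERTEX FAMILY OF A BI-STENCIL TABLE** through a packed kernel,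
`vsym K N T μ y ν y′ := ½ • (vertex2OfK K N T μ y ν y′ + vertex2OfK K N T ν y′ μ y)` — the `S₂`-dependent part of `W2SymOfK`. -/
def vsym (T : Fin (d + 1) → (Fin (d + 1) → ℤ) → Fin (d + 1) → (Fin (d + 1) → ℤ) → MKer (d + 1) (Fib d))
    (μ : Fin (d + 1)) (y : Fin (d + 1) → ℤ) (ν : Fin (d + 1)) (y' : Fin (d + 1) → ℤ) : MKer (d + 1) (Fib d) :=
  (1 / 2 : ℝ) • (vertex2OfK K N T μ y ν y' + vertex2OfK K N T ν y' μ y)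

/-- [folklore] **`W2SymOfK` IS AFFINE IN ITS BI-STENCIL SLOT**: `W2SymOfK K N S M S₂ M₂ = W2SymOfK K N S M 0 M₂ + vsym K N S₂`. -/
theorem W2SymOfK_eq_add_vsym (S M : Fin (d + 1) → (Fin (d + 1) → ℤ) → MKer (d + 1) (Fib d))
    (S₂ M₂ : Fin (d + 1) → (Fin (d + 1) → ℤ) → Fin (d + 1) → (Fin (d + 1) → ℤ) → MKer (d + 1) (Fib d)) :
    W2SymOfK K N S M S₂ M₂ = W2SymOfK K N S M 0 M₂ + vsym K N S₂ := by
  funext μ y ν y'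
  simp only [W2SymOfK, vsym, Pi.add_apply]
  rw [W2OfK_eq_add_vertex2OfK K N S M S₂ M₂ μ y ν y', W2OfK_eq_add_vertex2OfK K N S M S₂ M₂ ν y' μ y, ← smul_add]
  congr 1
  abel

end AffineS2

/-! ## §2 The second response-derivative is affine in its second-table slot (absolutely convergent series) -/

section AffineW

variable {D : ℕ} {F : Type*} [Fintype F]

/-- [folklore] **`K3OfK` IS AFFINE IN ITS SECOND-TABLE SLOT**: for a kernel `K` decaying at rate `δ > 0` and two second tables `W`, `W′` whose
members at the bond pair `(b, b′)` are bi-localised at rate `δ`, `K3OfK K N S M W b b′ = K3OfK K N S M W′ b b′ − K ∘ (W b b′ − W′ b b′) ∘ K`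
(the first two summands of `K3OfK` do not see `W`; the sandwich is additive because every slice converges absolutely:
`KernelWard.comp_sub_right` / `comp_sub_left` over `slices_bdd_biLoc` / `slices_biLoc_bdd` and `ExpKernelCalculus.biLoc_comp_decays`). -/
theorem K3OfK_eq_sub_of_W {K : MKer (d + 1) (Fib d)} {C δ : ℝ} (hK : Decays K C δ) (hδ : 0 < δ) (N : ℕ)
    (S M : Fin (d + 1) → (Fin (d + 1) → ℤ) → MKer (d + 1) (Fib d))
    {W W' : Fin (d + 1) → (Fin (d + 1) → ℤ) → Fin (d + 1) → (Fin (d + 1) → ℤ) → MKer (d + 1) (Fib d)}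
    {μ : Fin (d + 1)} {y : Fin (d + 1) → ℤ} {ν : Fin (d + 1)} {y' : Fin (d + 1) → ℤ} {p q : Fin (d + 1) → ℤ} {C₀ C₁ : ℝ}
    (h : BiLoc (W μ y ν y') p q C₀ δ) (h' : BiLoc (W' μ y ν y') p q C₁ δ) :
    K3OfK K N S M W μ y ν y' = K3OfK K N S M W' μ y ν y' - comp (comp K (W μ y ν y' - W' μ y ν y')) K := by
  have bK : Bdd K C := bdd_of_decays hK hδ.le
  have hδ2 : 0 < δ / 2 := half_pos hδ
  have c := biLoc_comp_decays hK h hδ2.le (half_lt_self hδ)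
  have c' := biLoc_comp_decays hK h' hδ2.le (half_lt_self hδ)
  have hin : comp K (W μ y ν y' - W' μ y ν y') = comp K (W μ y ν y') - comp K (W' μ y ν y') :=
    comp_sub_right (fun x z a b => slices_bdd_biLoc bK h hδ x z a b) (fun x z a b => slices_bdd_biLoc bK h' hδ x z a b)
  have hout : comp (comp K (W μ y ν y') - comp K (W' μ y ν y')) K =
      comp (comp K (W μ y ν y')) K - comp (comp K (W' μ y ν y')) K :=
    comp_sub_left (fun x z a b => slices_biLoc_bdd c bK hδ2 x z a b) (fun x z a b => slices_biLoc_bdd c' bK hδ2 x z a b)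
  rw [hin, hout]
  funext x z a b
  simp only [K3OfK, Pi.sub_apply]
  ring

end AffineW

/-! ## §3 The linear part of the normalised recursion -/

section Lin

/-- [folklore] Plumbing `def`: **THE LINEAR PART OF THE NORMALISED `T2Of` RECURSION** — a bi-stencil table `T` (normalised member `j`) is
sent to `lin4 c K N T κ u κ′ u′ := −(c • mmRead N (K ∘ vsym K N T κ u κ′ u′ ∘ K))` (normalised contribution to member `j+1` through the
`S₂` slot of the second-order family and the `−K∘W∘K` summand of the second response-derivative; for an2's objects `c = cE₂·Lc^{2(d+1)}`,
`K = K♮_j`, `N = Lc`).  A definition asserting nothing. -/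
def lin4 (c : ℝ) (K : MKer (d + 1) (Fib d)) (N : ℕ)
    (T : Fin (d + 1) → (Fin (d + 1) → ℤ) → Fin (d + 1) → (Fin (d + 1) → ℤ) → MKer (d + 1) (Fib d)) :
    Fin (d + 1) → (Fin (d + 1) → ℤ) → Fin (d + 1) → (Fin (d + 1) → ℤ) → MKer (d + 1) (Fib d) :=
  fun κ u κ' u' => -(c • mmRead N (comp (comp K (vsym K N T κ u κ' u')) K))

/-- [folklore] `lin4`, by `rfl`. -/
theorem lin4_apply (c : ℝ) (K : MKer (d + 1) (Fib d)) (N : ℕ)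
    (T : Fin (d + 1) → (Fin (d + 1) → ℤ) → Fin (d + 1) → (Fin (d + 1) → ℤ) → MKer (d + 1) (Fib d))
    (κ : Fin (d + 1)) (u : Fin (d + 1) → ℤ) (κ' : Fin (d + 1)) (u' : Fin (d + 1) → ℤ) :
    lin4 c K N T κ u κ' u' = -(c • mmRead N (comp (comp K (vsym K N T κ u κ' u')) K)) := rfl

variable {Lc : ℕ} [NeZero Lc] (cE cVH cΛ cE₂ cB : ℝ) (T : Fin 4 → Fin 4 → Fin 4 → Fin 4 → ℝ)
  {vh₂S : Fin (d + 1) → (Fin (d + 1) → ℤ) → Fin (d + 1) → (Fin (d + 1) → ℤ) → MKer (d + 1) (Fib d)}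
  (mixFF : Fin (d + 1) → (Fin (d + 1) → ℤ) → Fin (d + 1) → (Fin (d + 1) → ℤ) → MKer (d + 1) (Fib d))

/-- [folklore] **(U-T2) THE NORMALISED RECURSION IS AFFINE IN THE PREVIOUS MEMBER.**  In the K-slot units, with `K♮_j = unitK … (KInvStep Lc j)`,
`S♮_j = unitS … (Spure … j)`, `M♮_j = unitM … (M1 … j)`, `M₂♮_j = unitM₂ … (M2Of mixFF j)`, `T♮_j = unitS₂ … (T2Of … j)` (all at level-`j`
units `(sfStep Lc j, smStep d Lc j)`), for an off-diagonal-valued border `vh₂S`, a decaying `K♮_j` (rate `δ > 0`), and the normalised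
second-order member `W♮_j = W2SymOfK K♮_j Lc S♮_j M♮_j T♮_j M₂♮_j` together with its `T♮_j`-free part `W2SymOfK K♮_j Lc S♮_j M♮_j 0 M₂♮_j`
bi-localised at rate `δ` (`VertexFamily₂`: the wall's uniform W-row at level `j`, resp. an2's `vertexFamily₂_W2SymOfK` on the zero bi-table;
all series absolutely convergent):
`T♮_{j+1} = [ (cE₂·Lc^{2(d+1)}) • mmRead Lc ∘ K3OfK K♮_j Lc S♮_j M♮_j (W2SymOfK K♮_j Lc S♮_j M♮_j 0 M₂♮_j) + cB • mfNeg ∘ vh₂S ] + lin4 (cE₂·Lc^{2(d+1)}) K♮_j Lc T♮_j`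
— the bracket does not see `T♮_j`. -/
theorem unitS₂_T2Of_succ_affine
    (hBff : ∀ κ u κ' u' x z (α β : Fin (d + 1)), vh₂S κ u κ' u' x z (Sum.inl α) (Sum.inl β) = 0)
    (hBmm : ∀ κ u κ' u' x z (μ ν : Fin (d + 1)), vh₂S κ u κ' u' x z (Sum.inr μ) (Sum.inr ν) = 0) (j : ℕ) {C δ C₀ C₁ : ℝ} (hδ : 0 < δ)
    (hK : Decays (unitK (sfStep Lc j) (smStep d Lc j) (KInvStep (d := d) Lc j)) C δ)
    (h₀ : VertexFamily₂ (W2SymOfK (unitK (sfStep Lc j) (smStep d Lc j) (KInvStep (d := d) Lc j)) Lc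
      (unitS (sfStep Lc j) (smStep d Lc j) (Spure d Lc cE cVH cΛ j)) (unitM (sfStep Lc j) (smStep d Lc j) (M1 d Lc cΛ j)) 0
      (unitM₂ (sfStep Lc j) (smStep d Lc j) (M2Of d Lc mixFF j))) Lc C₀ δ)
    (hWj : VertexFamily₂ (W2SymOfK (unitK (sfStep Lc j) (smStep d Lc j) (KInvStep (d := d) Lc j)) Lc
      (unitS (sfStep Lc j) (smStep d Lc j) (Spure d Lc cE cVH cΛ j)) (unitM (sfStep Lc j) (smStep d Lc j) (M1 d Lc cΛ j))
      (unitS₂ (sfStep Lc j) (smStep d Lc j) (T2Of d Lc cE cVH cΛ cE₂ cB T vh₂S mixFF j))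
      (unitM₂ (sfStep Lc j) (smStep d Lc j) (M2Of d Lc mixFF j))) Lc C₁ δ) :
    unitS₂ (sfStep Lc (j + 1)) (smStep d Lc (j + 1)) (T2Of d Lc cE cVH cΛ cE₂ cB T vh₂S mixFF (j + 1)) = fun κ u κ' u' =>
      ((cE₂ * (Lc : ℝ) ^ (2 * (d + 1))) •
          mmRead Lc (K3OfK (unitK (sfStep Lc j) (smStep d Lc j) (KInvStep (d := d) Lc j)) Lc
            (unitS (sfStep Lc j) (smStep d Lc j) (Spure d Lc cE cVH cΛ j)) (unitM (sfStep Lc j) (smStep d Lc j) (M1 d Lc cΛ j))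
            (W2SymOfK (unitK (sfStep Lc j) (smStep d Lc j) (KInvStep (d := d) Lc j)) Lc
              (unitS (sfStep Lc j) (smStep d Lc j) (Spure d Lc cE cVH cΛ j)) (unitM (sfStep Lc j) (smStep d Lc j) (M1 d Lc cΛ j)) 0
              (unitM₂ (sfStep Lc j) (smStep d Lc j) (M2Of d Lc mixFF j))) κ u κ' u')
        + cB • mfNeg (vh₂S κ u κ' u'))
      + lin4 (cE₂ * (Lc : ℝ) ^ (2 * (d + 1))) (unitK (sfStep Lc j) (smStep d Lc j) (KInvStep (d := d) Lc j)) Lc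
          (unitS₂ (sfStep Lc j) (smStep d Lc j) (T2Of d Lc cE cVH cΛ cE₂ cB T vh₂S mixFF j)) κ u κ' u' := by
  rw [unitS₂_T2Of_succ (Lc := Lc) cE cVH cΛ cE₂ cB T vh₂S mixFF hBff hBmm j]
  funext κ u κ' u'
  have hvs : W2SymOfK (unitK (sfStep Lc j) (smStep d Lc j) (KInvStep (d := d) Lc j)) Lc
        (unitS (sfStep Lc j) (smStep d Lc j) (Spure d Lc cE cVH cΛ j)) (unitM (sfStep Lc j) (smStep d Lc j) (M1 d Lc cΛ j))
        (unitS₂ (sfStep Lc j) (smStep d Lc j) (T2Of d Lc cE cVH cΛ cE₂ cB T vh₂S mixFF j))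
        (unitM₂ (sfStep Lc j) (smStep d Lc j) (M2Of d Lc mixFF j)) κ u κ' u' -
      W2SymOfK (unitK (sfStep Lc j) (smStep d Lc j) (KInvStep (d := d) Lc j)) Lc
        (unitS (sfStep Lc j) (smStep d Lc j) (Spure d Lc cE cVH cΛ j)) (unitM (sfStep Lc j) (smStep d Lc j) (M1 d Lc cΛ j)) 0
        (unitM₂ (sfStep Lc j) (smStep d Lc j) (M2Of d Lc mixFF j)) κ u κ' u' =
      vsym (unitK (sfStep Lc j) (smStep d Lc j) (KInvStep (d := d) Lc j)) Lc
        (unitS₂ (sfStep Lc j) (smStep d Lc j) (T2Of d Lc cE cVH cΛ cE₂ cB T vh₂S mixFF j)) κ u κ' u' := by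
    rw [W2SymOfK_eq_add_vsym (unitK (sfStep Lc j) (smStep d Lc j) (KInvStep (d := d) Lc j)) Lc
      (unitS (sfStep Lc j) (smStep d Lc j) (Spure d Lc cE cVH cΛ j)) (unitM (sfStep Lc j) (smStep d Lc j) (M1 d Lc cΛ j))
      (unitS₂ (sfStep Lc j) (smStep d Lc j) (T2Of d Lc cE cVH cΛ cE₂ cB T vh₂S mixFF j))]
    simp only [Pi.add_apply, add_sub_cancel_left]
  rw [K3OfK_eq_sub_of_W hK hδ Lc _ _ (hWj κ u κ' u') (h₀ κ u κ' u'), hvs, mmRead_sub, smul_sub, lin4_apply]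
  abel

end Lin

/-! ## §4 The one-step DIFFERENCE form of the normalised recursion (the «T2SupRate» input shape of leaf-01's √-route) -/

section Diff

variable {Lc : ℕ} [NeZero Lc] (cE cVH cΛ cE₂ cB : ℝ) (T : Fin 4 → Fin 4 → Fin 4 → Fin 4 → ℝ)
  (vh₂S mixFF : Fin (d + 1) → (Fin (d + 1) → ℤ) → Fin (d + 1) → (Fin (d + 1) → ℤ) → MKer (d + 1) (Fib d))

/-- [folklore] **THE BORDER CANCELS IN ONE-STEP DIFFERENCES**: for an off-diagonal-valued border table and every `j`, the difference of the
normalised members `j+2` and `j+1` of an2's `T2Of` is the `j`-FREE scalar `cE₂·Lc^{2(d+1)}` times the difference of the value 4-jet carriers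
of the normalised step-`(j+1)` and step-`j` data (leaf-19's `T2SlotUnits.unitS₂_T2Of_succ` twice) — the ENTRYWISE object whose `j`-geometric
sup bound is «T2SupRate» (leaf-01's `WSlotSupRate` route); no estimate here. -/
theorem unitS₂_T2Of_succ_sub
    (hBff : ∀ κ u κ' u' x z (α β : Fin (d + 1)), vh₂S κ u κ' u' x z (Sum.inl α) (Sum.inl β) = 0)
    (hBmm : ∀ κ u κ' u' x z (μ ν : Fin (d + 1)), vh₂S κ u κ' u' x z (Sum.inr μ) (Sum.inr ν) = 0) (j : ℕ) :
    (fun κ u κ' u' => unitS₂ (sfStep Lc (j + 2)) (smStep d Lc (j + 2)) (T2Of d Lc cE cVH cΛ cE₂ cB T vh₂S mixFF (j + 2)) κ u κ' u' -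
        unitS₂ (sfStep Lc (j + 1)) (smStep d Lc (j + 1)) (T2Of d Lc cE cVH cΛ cE₂ cB T vh₂S mixFF (j + 1)) κ u κ' u') =
      fun κ u κ' u' => (cE₂ * (Lc : ℝ) ^ (2 * (d + 1))) •
        (mmRead Lc (K3OfK (unitK (sfStep Lc (j + 1)) (smStep d Lc (j + 1)) (KInvStep (d := d) Lc (j + 1))) Lc
            (unitS (sfStep Lc (j + 1)) (smStep d Lc (j + 1)) (Spure d Lc cE cVH cΛ (j + 1)))
            (unitM (sfStep Lc (j + 1)) (smStep d Lc (j + 1)) (M1 d Lc cΛ (j + 1)))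
            (W2SymOfK (unitK (sfStep Lc (j + 1)) (smStep d Lc (j + 1)) (KInvStep (d := d) Lc (j + 1))) Lc
              (unitS (sfStep Lc (j + 1)) (smStep d Lc (j + 1)) (Spure d Lc cE cVH cΛ (j + 1)))
              (unitM (sfStep Lc (j + 1)) (smStep d Lc (j + 1)) (M1 d Lc cΛ (j + 1)))
              (unitS₂ (sfStep Lc (j + 1)) (smStep d Lc (j + 1)) (T2Of d Lc cE cVH cΛ cE₂ cB T vh₂S mixFF (j + 1)))
              (unitM₂ (sfStep Lc (j + 1)) (smStep d Lc (j + 1)) (M2Of d Lc mixFF (j + 1)))) κ u κ' u') -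
          mmRead Lc (K3OfK (unitK (sfStep Lc j) (smStep d Lc j) (KInvStep (d := d) Lc j)) Lc
            (unitS (sfStep Lc j) (smStep d Lc j) (Spure d Lc cE cVH cΛ j)) (unitM (sfStep Lc j) (smStep d Lc j) (M1 d Lc cΛ j))
            (W2SymOfK (unitK (sfStep Lc j) (smStep d Lc j) (KInvStep (d := d) Lc j)) Lc
              (unitS (sfStep Lc j) (smStep d Lc j) (Spure d Lc cE cVH cΛ j)) (unitM (sfStep Lc j) (smStep d Lc j) (M1 d Lc cΛ j))
              (unitS₂ (sfStep Lc j) (smStep d Lc j) (T2Of d Lc cE cVH cΛ cE₂ cB T vh₂S mixFF j))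
              (unitM₂ (sfStep Lc j) (smStep d Lc j) (M2Of d Lc mixFF j))) κ u κ' u')) := by
  have h2 := unitS₂_T2Of_succ (Lc := Lc) cE cVH cΛ cE₂ cB T vh₂S mixFF hBff hBmm (j + 1)
  have h1 := unitS₂_T2Of_succ (Lc := Lc) cE cVH cΛ cE₂ cB T vh₂S mixFF hBff hBmm j
  funext κ u κ' u'
  have e2 := congrFun (congrFun (congrFun (congrFun h2 κ) u) κ') u'
  have e1 := congrFun (congrFun (congrFun (congrFun h1 κ) u) κ') u'
  rw [show j + 2 = j + 1 + 1 from rfl, e2, e1, smul_sub]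
  abel

end Diff

end Summit.QuantumFields.BalabanUV.Beta.GAN24.T2RecursionAffine

end
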